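import Mathlib
import Summits.Ventures.PercRepro.TriangleCapSubBandOne

/-!
# PercRepro — THE SECOND GAP OF THE BAND ON `n` VERTICES: NO VALUE `t + ℓ − 2 ≤ j ≤ 2 t − 7` (p3, gen 52; part 256)

With `ℓ + 2 ≤ t` non-neighbours of `w`, the band value `2 j` of a triangle-free graph with `t` off-edges at `w` has
`j + 3 ≤ t + ℓ` or `2 t ≤ j + 6` (`second_gap`): by the second max-degree `Δ(F) = t − u` of the off-edge graph —
`u = 0` (the star: `j ≤ ℓ − 1`, part 253), `u = 1` (the `(t − 1)`-star plus one edge: `j ≤ t + ℓ − 3`, part 255;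
its centre is a non-neighbour because a neighbour of `w` carries at most `ℓ` off-edges), `2 ≤ u ≤ t − 3` (the
sub-band bound `j ≥ u (t − u − 1) ≥ 2 (t − 3)`, part 252) or every off-degree `≤ 2` (`offAdjPairs ≤ 2 t`, so
`2 j ≥ t (t − 3) ≥ 4 (t − 3)`).  Hence on `ℓ + 1 + (s − t)` vertices with `ℓ + 5 ≤ t` the values
`t + ℓ − 2 ≤ j ≤ 2 t − 7` are not attained (`second_gap_not_attained`), and below `2 t − 6` the band is EXACTLY
`j ≤ ℓ − 1` together with `t − 2 ≤ j ≤ t + ℓ − 3` (`band_below_second_iff`, with part 254).  Axioms: standard.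
-/

namespace PercRepro

namespace TriangleCap

namespace C047

open Finset

variable {V : Type*} [Fintype V] [DecidableEq V]

/-- A neighbour of `w` carries at most `|nonNbrs|` off-edges: their second ends are distinct non-neighbours. -/
theorem offDeg_le_card_nonNbrs_of_adj (H : SimpleGraph V) [DecidableRel H.Adj] (hfree : H.CliqueFree 3) (w x : V)
    (hxN : H.Adj w x) : offDeg H w x ≤ (nonNbrs H w).card := by
  unfold offDeg
  apply card_le_card_of_injOn (otherEnd x)
  · intro e he
    rw [mem_coe, mem_filter] at he
    rw [mem_coe]
    have hne := mem_edgeFinset_of_mem_offEdges H w he.1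
    have hdiag : ¬ e.IsDiag := H.not_isDiag_of_mem_edgeSet (SimpleGraph.mem_edgeFinset.mp hne)
    unfold otherEnd
    rw [dif_pos he.2, mem_nonNbrs]
    refine ⟨?_, ?_⟩
    · intro hw
      exact notMem_of_mem_offEdges H w he.1 (hw ▸ Sym2.other_mem he.2)
    · intro hy
      have hone := card_adj_mem_le_one H hfree w e hne
      have : 1 < (univ.filter (fun v => H.Adj w v ∧ v ∈ e)).card :=
        one_lt_card.mpr ⟨x, mem_filter.mpr ⟨mem_univ _, hxN, he.2⟩, Sym2.Mem.other he.2,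
          mem_filter.mpr ⟨mem_univ _, hy, Sym2.other_mem he.2⟩, (Sym2.other_ne hdiag he.2).symm⟩
      omega
  · intro e he e' he' heq
    rw [mem_coe, mem_filter] at he he'
    unfold otherEnd at heq
    rw [dif_pos he.2, dif_pos he'.2] at heq
    rw [← Sym2.other_spec he.2, ← Sym2.other_spec he'.2, heq]

/-- The arithmetic of the second gap: `2 ≤ u`, `u + 3 ≤ t` ⇒ `2 (t − 3) ≤ u (t − u − 1)`. -/
theorem two_mul_sub_three_le_mul (t u : ℕ) (hu1 : 2 ≤ u) (hu2 : u + 3 ≤ t) : 2 * (t - 3) ≤ u * (t - u - 1) := by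
  obtain ⟨u', rfl⟩ : ∃ u', u = u' + 2 := ⟨u - 2, by omega⟩
  obtain ⟨v, rfl⟩ : ∃ v, t = u' + 2 + v + 3 := ⟨t - u' - 5, by omega⟩
  have e : u' + 2 + v + 3 - (u' + 2) - 1 = v + 2 := by omega
  have e' : u' + 2 + v + 3 - 3 = u' + v + 2 := by omega
  rw [e, e']
  nlinarith

/-- **THE SECOND GAP:** with `ℓ + 2 ≤ t` non-neighbours, at the band value `2 j`, `j + 3 ≤ t + ℓ` or `2 t ≤ j + 6`:
no band value `t + ℓ − 2 ≤ j ≤ 2 t − 7`. -/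
theorem second_gap (H : SimpleGraph V) [DecidableRel H.Adj] (hfree : H.CliqueFree 3) (s t j : ℕ)
    (hs : H.edgeFinset.card = s) (w : V) (hw : 1 ≤ deg H w) (ht : (offEdges H w).card = t)
    (hj : ∑ v, deg H v * deg H v + 2 * (t * (s - t - 1)) + 2 * j = s * (s + 1))
    (hℓ : (nonNbrs H w).card + 2 ≤ t) :
    j + 3 ≤ t + (nonNbrs H w).card ∨ 2 * t ≤ j + 6 := by
  by_cases h0 : ∃ x, offDeg H w x = t
  · obtain ⟨x, hx⟩ := h0
    left
    have := band_succ_le_of_star H hfree s t j hs w hw ht hj x hx (by omega)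
    omega
  by_cases h1 : ∃ x, offDeg H w x + 1 = t
  · obtain ⟨x, hx⟩ := h1
    left
    have hxN : ¬ H.Adj w x := by
      intro hxN
      have := offDeg_le_card_nonNbrs_of_adj H hfree w x hxN
      omega
    exact band_le_of_offDeg_pred H hfree s t j hs w hw ht hj x hx hxN (by omega)
  by_cases h2 : ∃ x, 3 ≤ offDeg H w x
  · obtain ⟨x, hx⟩ := h2
    right
    simp only [not_exists] at h0 h1
    have hle := offDeg_le_card H w x
    rw [ht] at hle
    have hne0 := h0 x
    have hne1 := h1 x
    have hb := subband_lower_bound H hfree s t (t - offDeg H w x) j hs w hw ht hj x (by omega)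
    have := two_mul_sub_three_le_mul t (t - offDeg H w x) (by omega) (by omega)
    omega
  · right
    simp only [not_exists, not_le] at h2
    have hval := (layer_value_iff H s t j hs w hw ht).mp hj
    have hatt := attach_le H hfree w
    rw [ht] at hatt
    have hP := offAdjPairs_le_of_offDeg_le_two H w (fun v => by have := h2 v; omega)
    rw [ht] at hP
    rcases Nat.lt_or_ge t 4 with h4 | h4
    · omega
    · obtain ⟨t', rfl⟩ : ∃ t', t = t' + 4 := ⟨t - 4, by omega⟩
      nlinarith

/-- **THE SECOND GAP ON `n` VERTICES:** on `ℓ + 1 + (s − t)` vertices with `ℓ + 2 ≤ t`, at the band value `2 j` of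
a vertex of degree `s − t ≥ 1`, `j + 3 ≤ t + ℓ ∨ 2 t ≤ j + 6`. -/
theorem second_gap_vertices (ℓ s t : ℕ) (H : SimpleGraph (Fin (ℓ + 1 + (s - t)))) [DecidableRel H.Adj]
    (hfree : H.CliqueFree 3) (hs : H.edgeFinset.card = s) (w : Fin (ℓ + 1 + (s - t))) (hw : deg H w + t = s)
    (hw1 : 1 ≤ deg H w) (hℓ : ℓ + 2 ≤ t) (j : ℕ)
    (hj : ∑ v, deg H v * deg H v + 2 * (t * (s - t - 1)) + 2 * j = s * (s + 1)) :
    j + 3 ≤ t + ℓ ∨ 2 * t ≤ j + 6 := by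
  have hc := card_nonNbrs_add H w
  rw [Fintype.card_fin] at hc
  have hcard := card_offEdges_add_deg H w
  have := second_gap H hfree s t j hs w hw1 (by omega) hj (by omega)
  omega

/-- **THE SECOND GAP IS A GAP:** for `ℓ + 5 ≤ t`, `2 t ≤ s`, no triangle-free graph on `ℓ + 1 + (s − t)` vertices with
`s` edges and a vertex of degree `s − t` has the band value `2 j` with `t + ℓ − 2 ≤ j ≤ 2 t − 7`. -/
theorem second_gap_not_attained (ℓ s t j : ℕ) (ht : ℓ + 5 ≤ t) (hs : 2 * t ≤ s) (hj1 : t + ℓ ≤ j + 2)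
    (hj2 : j + 7 ≤ 2 * t) :
    ¬ ∃ (H : SimpleGraph (Fin (ℓ + 1 + (s - t)))) (_ : DecidableRel H.Adj), H.CliqueFree 3 ∧
      H.edgeFinset.card = s ∧ (∃ w, deg H w + t = s) ∧
      ∑ v, deg H v * deg H v + 2 * (t * (s - t - 1)) + 2 * j = s * (s + 1) := by
  rintro ⟨H, _, hfree, hs', ⟨w, hw⟩, hj'⟩
  have := second_gap_vertices ℓ s t H hfree hs' w hw (by omega) (by omega) j hj'
  omega

/-- **THE BAND ON `n` VERTICES BELOW `2 t − 6`, EXACTLY:** for `2 ≤ ℓ`, `ℓ + 5 ≤ t`, `2 t ≤ s` and `j + 7 ≤ 2 t`, the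
band value `2 j` is attained on `ℓ + 1 + (s − t)` vertices iff `j ≤ ℓ − 1` or `t − 2 ≤ j ≤ t + ℓ − 3`. -/
theorem band_below_second_iff (ℓ s t j : ℕ) (hℓ : 2 ≤ ℓ) (ht : ℓ + 5 ≤ t) (hs : 2 * t ≤ s)
    (hj : j + 7 ≤ 2 * t) :
    (∃ (H : SimpleGraph (Fin (ℓ + 1 + (s - t)))) (_ : DecidableRel H.Adj), H.CliqueFree 3 ∧
      H.edgeFinset.card = s ∧ (∃ w, deg H w + t = s) ∧
      ∑ v, deg H v * deg H v + 2 * (t * (s - t - 1)) + 2 * j = s * (s + 1)) ↔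
    (j + 1 ≤ ℓ ∨ (t ≤ j + 2 ∧ j + 3 ≤ t + ℓ)) := by
  constructor
  · rintro ⟨H, _, hfree, hs', ⟨w, hw⟩, hj'⟩
    have h1 := first_gap_vertices ℓ s t H hfree hs' w hw (by omega) j hj'
    have h2 := second_gap_vertices ℓ s t H hfree hs' w hw (by omega) (by omega) j hj'
    omega
  · intro h
    have hj' : j + 3 ≤ t + ℓ := by omega
    exact (top_of_band_vertices_iff ℓ s t j hℓ (by omega) hs hj').mpr (by omega)

end C047

end TriangleCap

end PercRepro
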